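import Summits.QuantumFields.YangMills.Theorems.BalabanUVNodesN10AtRecord12B13Family
import Literature.MathematicalPhysics.QuantumFieldTheory.Balaban1983to89.Node00.Record12NumericsFamily

/-!
# BalabanUVNodes ∕ N10's LETTER ROWS AT NODE 00's FAMILY WITNESS θ₀ᶠᵃᵐ(ε₀) — the (I.1.18)-rate rows CLOSE (κ := 2·10⁴ re-pinned by node00-def-K0a's
# `Node00/Record12NumericsFamily`), the BLOCK-SIZE row OPENS (LOCATED-N10-ELL: the Stage-1∕3 dictionary of record has `L = 3`, so [Balaban1988RG2Cluster] Lemma 3's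
# LEVEL-T road, which enters through (2.36) AS PRINTED (`8 ≤ L`), is VACUOUS at every K0′ witness typed so far; print's window `L` odd `> 11` makes the binder a theorem)
# (Track A, DAG node N10 [B13]; strategy s2 «by-name knit at the record»; seat `pub-ymgap-dag-n10-d` g5; leaf module of `…N10AtRecord12B13Family` p480148∕p482076)

HONEST FRAMING.  Count-neutral kernel bookkeeping + LOCATED NUMERALS over LANDED modules: node00-def-K0a's `Node00/Record12NumericsFamily` (p484513: the term constants
OF THE FAMILY `lfConstsOfFamily = {lfConstsOfRecord₁₂ with κ := 20000}`, the RE-PINNED STAGE-12 WITNESS OF THE FAMILY `theta12OfFamily F N ε₀ ζ Rz Zt` (`ε₀` an open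
letter, row N2), its live re-pin `theta12LiveOfFamily`, the faces `theta12OfFamily_κ : ….s2.lf.κ = 20000`, `theta12OfFamily_ℓ₆ : ….ℓ₆ = 2`, `kp_n10_theta12OfFamily`),
NODE 00's `Record12Numerics` (the maker `stage12OfNumerics` over the dictionary of record `stage3OfRecord₁₂` — `L := 3`, `ℓ₆ := 2` —, `theta12OfRecord`),
`Record12LiveSelector` (`Stage12Params.liveRepin`, `theta12LiveOfRecord`), and this seat's `…N10AtRecord12B13Family` §3b (`thresholds_of_kappa_ge`: `2·10⁴ ≤ θ.s2.lf.κ` and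
`16κ + 1 ≤ c.κ₁` ⟹ the six k-uniform rate thresholds of Lemma 1 at the letters of record `c13OfRecord₁₂ θ c`, every `L ≥ 3`).
§1 (dag-lead's `RECORD13-CLOSABILITY-GATE.md` ROW N1, N10's «one example»): AT θ₀ᶠᵃᵐ(ε₀) the six rate rows of `…N10AtRecord12B13Family` §1 (`hκ hδκ hκ126 hκ126' hR8 hR9`)
HOLD for every `ε₀, ζ, Rz, Zt` and every residual letter record `c` with `κ₁ ≥ 320001 = 16·2·10⁴ + 1` — the κ-side of FLAG-K0′-KAPPA is NON-VACUOUS at the family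
witness (the remaining located inputs of §1 — per-term data, `hC` on `E₀`, the residual rows on `κ₁, δ₀M`, the Lemma-3 side — are untouched by this; nothing is
stated «N10 holds at θ₀ᶠᵃᵐ»).
§2 ★ LOCATED-N10-ELL (a located numeric demand on the witness, NOT a refutation of anything of Bałaban's — print's `L` IS large, [I] p.251 «L is an odd, positive
integer > 11»): EVERY witness made by `Record12Numerics`' maker — `stage12OfNumerics F N n res ζ Rz Zt`, hence θ₀ = `theta12OfRecord`, θ₀ᶠᵃᵐ(ε₀) = `theta12OfFamily`,
and their live re-pins (`liveRepin` keeps the Stage-8 part) — carries the dictionary of record, `ℓ₆ = 2` (`L = 3`), by `rfl`; so the displayed binder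
`hL8 : 8 ≤ θ.ℓ₆ + 1` of N10's LEVEL-T faces (NO Lemma-3 FLAG: `…N10AtRecord12B13Family.b13FamLeafOfRecord₁₂_of_located_termwise`,
`…N10AtRecord11B13Family.b13FamLeafOfRecord_of_located_termwise`, `…N10AtRecord11B13.b13LeafOfRecord_of_located_termwise`, `…N10AtRecord11B13Halves.bound238OfRecord_of_termwise226`
∕ `lemma3OfRecord_of_termwise226` — through the last one also dag-n26-c's (2.38)-consumers at the record) is FALSE there (`not_eight_le_L_*`): at these witnesses
Lemma 3 can only be CARRIED AS THE FLAG (`…_of_located`, `h3 : B13.Lemma3Printed …`).  WHY `8 ≤ L`: Lemma 3's scale transfer (2.36) AS PRINTED «2d_k(Z_i) ≧ L·d_{k+1}(Z′_i)»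
([II] p.19, used p.20 ll.2–3) is the tree theorem `TreeLengthTorusGeometry236Printed.ineq236Printed_torus (hL : 8 ≤ L)` (kernel constant 3∕2 + 3∕(L − 2) ≤ 2 ⟺ L ≥ 8),
consumed by `B13Lemma3TorusSocket.h238_of_termwise_half (hL : 8 ≤ c.L)`.  THE CURE's shape (for Record 13's numerics re-pin, node00-def-K0a's idiom «the witness
numerics must READ THE FAMILY»): a dictionary whose block size IS a `T4Family`'s `F.L` (`T4Family.hL : Odd L ∧ 1 < L` has `Stage1Params.hL`'s shape; `T4Family.hL11 :
11 < L`) makes the binder a THEOREM — `eight_le_L_of_L_eq_family` (here, generic; the re-pinned dictionary itself is the K0′ lineage's to declare, not this seat's).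
The rows of §1 do NOT read `L` beyond `L ≥ 3` (`thresholds_of_kappa_ge` holds at every `L ≥ 3`), so the κ re-pin and an L re-pin are independent.
Nothing of Bałaban's is asserted; N10 is NOT discharged; K0′ is NOT asserted; no node count moves; one finite four-torus programme at fixed ε per run; nothing
continuum ∕ ℝ⁴ ∕ OS ∕ mass-gap ∕ Clay.  0 `sorry`, 0 `def`, standard axioms.  Filed `--supports` K1′ «StabilityBAtRecordR12e» (stmt-QuantumFields-19903) of route «BalabanUVNodes».

WHAT THIS FILE PROVES.  §1 `thresholds_theta12OfFamily`, `kappa_theta12LiveOfFamily`, `thresholds_theta12LiveOfFamily`.  §2 `ell6_stage12OfNumerics` ∕ `L_stage12OfNumerics`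
(rfl), `liveRepin_ℓ₆` (rfl), `not_eight_le_L_stage12OfNumerics`, `not_eight_le_L_liveRepin_stage12OfNumerics`, `not_eight_le_L_theta12OfRecord` ∕ `_theta12LiveOfRecord` ∕
`_theta12OfFamily` ∕ `_theta12LiveOfFamily` (+ `ell6_theta12OfRecord`, rfl), `twelve_le_three_mul_iff` (the other dictionary-reading binder `hN12 : 12 ≤ (ℓ₆+1)(n+1)` at `L = 3` ⟺ `3 ≤ n`),
`eight_le_L_of_L_eq_family` (print's window ⇒ the binder), `eight_le_familyL`, `eight_le_L_of_stage3_L_eq`.  §3 `kappa1_rows_of_ge`,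
`b13FamLeafOfRecord₁₂_of_located_of_kappa_ge` (the FLAG junction of `…N10AtRecord12B13Family` §1 with its eight rate ∕ κ₁ rows discharged by `2·10⁴ ≤ κ`, `κ₁ ≥ 16κ + 1`).
-/

namespace Summit.QuantumFields.YangMills.BalabanUVNodes.N10AtRecord12B13FamilyWitness

open Literature.MathematicalPhysics.QuantumFieldTheory.Balaban1983to89
open Literature.MathematicalPhysics.QuantumFieldTheory.Balaban1983to89.T4Continuum
open Literature.MathematicalPhysics.QuantumFieldTheory.Balaban1983to89.DagBinding
open Literature.MathematicalPhysics.QuantumFieldTheory.Balaban1983to89.Node00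
open Literature.MathematicalPhysics.QuantumFieldTheory.Balaban1983to89.B12TreeDecay (kappa₀ K₀)
open Literature.MathematicalPhysics.QuantumFieldTheory.Balaban1983to89.B16Absorption (pbox)
open Literature.MathematicalPhysics.QuantumFieldTheory.Balaban1983to89.TreeLengthTorus
open Literature.MathematicalPhysics.QuantumFieldTheory.Balaban1983to89.TreeLengthTorusTransfer (tcoarse)
open Literature.MathematicalPhysics.QuantumFieldTheory.Balaban1983to89.B13PkScaling (scaled)
open Summit.QuantumFields.YangMills.BalabanUVNodes.N10AtRecord12B13Family (thresholds_of_kappa_ge b13FamLeafOfRecord₁₂_of_located)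
open Metric
open scoped Matrix.Norms.L2Operator

/-! ## §1. THE κ ROWS CLOSE at the family witness θ₀ᶠᵃᵐ(ε₀) (gate ROW N1, N10's side) -/

section Kappa

variable (F : T4Family) (N : ℕ) [NeZero N] (ε₀ : ℝ)
variable (ζ : ZetaOfRecord F N (numerics7OfFamily ε₀) 1) (Rz : (K : ℕ) → Sect2.Residual (F.P K) (MatA N)) (Zt : (K : ℕ) → TkResidualW F N (FluctV N) K)
variable (c : B13.Consts)

/-- **N10's RATE ROWS ARE NON-VACUOUS AT THE FAMILY WITNESS θ₀ᶠᵃᵐ(ε₀)** (node00-def-K0a's `theta12OfFamily`, `s2.lf.κ = 2·10⁴`): for every `ε₀, ζ, Rz, Zt` and every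
residual letter record `c` with `κ₁ ≥ 320001` (N10's own residual letter; print: κ₁ is as large as needed, [II] R7–R9 p.9), the SIX k-uniform Lemma-1 thresholds of
`…N10AtRecord12B13Family.b13FamLeafOfRecord₁₂_of_located` that read θ's (I.1.18) rate — `0 ≤ κ`, `1 ≤ δκ`, `κ₀(64,8) ≤ κ`, `κ₀(64,8) ≤ δκ`, R8 `(1 − δ)κ ≤ ¼(κ₁ − 1)`,
R9 `(1 − 2δ)κ ≤ κ₁∕16` at the record's `δ = (1 − 2∕L)∕10` — HOLD (`thresholds_of_kappa_ge` at `kp_n10_theta12OfFamily`).  A located numeric certificate; nothing of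
Bałaban's estimated. [cite: Balaban1988RG2Cluster, (1.26) p.8, p.9 (R7–R9 before Lemma 1), p.21 (after (2.41): δ, «κ sufficiently large»); Balaban1987RG1, (1.18) p.263] -/
theorem thresholds_theta12OfFamily (hκ₁ : 320001 ≤ c.κ₁) :
    0 ≤ (theta12OfFamily F N ε₀ ζ Rz Zt).s2.lf.κ ∧
      1 ≤ (c13OfRecord₁₂ F N (theta12OfFamily F N ε₀ ζ Rz Zt) c).δ * (theta12OfFamily F N ε₀ ζ Rz Zt).s2.lf.κ ∧
      kappa₀ 64 8 ≤ (theta12OfFamily F N ε₀ ζ Rz Zt).s2.lf.κ ∧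
      kappa₀ 64 8 ≤ (c13OfRecord₁₂ F N (theta12OfFamily F N ε₀ ζ Rz Zt) c).δ * (theta12OfFamily F N ε₀ ζ Rz Zt).s2.lf.κ ∧
      (1 - (c13OfRecord₁₂ F N (theta12OfFamily F N ε₀ ζ Rz Zt) c).δ) * (theta12OfFamily F N ε₀ ζ Rz Zt).s2.lf.κ ≤ (1 / 4) * (c.κ₁ - 1) ∧
      (1 - 2 * (c13OfRecord₁₂ F N (theta12OfFamily F N ε₀ ζ Rz Zt) c).δ) * (theta12OfFamily F N ε₀ ζ Rz Zt).s2.lf.κ ≤ (1 / 16) * c.κ₁ :=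
  thresholds_of_kappa_ge F N (theta12OfFamily F N ε₀ ζ Rz Zt) c (kp_n10_theta12OfFamily F N ε₀ ζ Rz Zt)
    (by rw [theta12OfFamily_κ]; linarith)

/-- The live re-pin of the family witness carries the same (I.1.18) rate `2·10⁴` (`rfl`: `liveRepin` touches only the `p–p′` selector). [cite: Balaban1987RG1, (1.18) p.263 (bookkeeping)] -/
theorem kappa_theta12LiveOfFamily : (theta12LiveOfFamily F N ε₀ ζ Rz Zt).s2.lf.κ = 20000 := rfl

/-- **The same six rate rows at the LIVE family witness θ₀ᶠᵃᵐ,ˡⁱᵛᵉ(ε₀)** (`theta12LiveOfFamily`, K0′'s witness-of-record candidate per node00-def-K0a FILE 7∕8).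
[cite: Balaban1988RG2Cluster, (1.26) p.8, p.9 (R7–R9), p.21 (after (2.41)); Balaban1987RG1, (1.18) p.263] -/
theorem thresholds_theta12LiveOfFamily (hκ₁ : 320001 ≤ c.κ₁) :
    0 ≤ (theta12LiveOfFamily F N ε₀ ζ Rz Zt).s2.lf.κ ∧
      1 ≤ (c13OfRecord₁₂ F N (theta12LiveOfFamily F N ε₀ ζ Rz Zt) c).δ * (theta12LiveOfFamily F N ε₀ ζ Rz Zt).s2.lf.κ ∧
      kappa₀ 64 8 ≤ (theta12LiveOfFamily F N ε₀ ζ Rz Zt).s2.lf.κ ∧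
      kappa₀ 64 8 ≤ (c13OfRecord₁₂ F N (theta12LiveOfFamily F N ε₀ ζ Rz Zt) c).δ * (theta12LiveOfFamily F N ε₀ ζ Rz Zt).s2.lf.κ ∧
      (1 - (c13OfRecord₁₂ F N (theta12LiveOfFamily F N ε₀ ζ Rz Zt) c).δ) * (theta12LiveOfFamily F N ε₀ ζ Rz Zt).s2.lf.κ ≤ (1 / 4) * (c.κ₁ - 1) ∧
      (1 - 2 * (c13OfRecord₁₂ F N (theta12LiveOfFamily F N ε₀ ζ Rz Zt) c).δ) * (theta12LiveOfFamily F N ε₀ ζ Rz Zt).s2.lf.κ ≤ (1 / 16) * c.κ₁ :=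
  thresholds_of_kappa_ge F N (theta12LiveOfFamily F N ε₀ ζ Rz Zt) c (by rw [kappa_theta12LiveOfFamily]; norm_num)
    (by rw [kappa_theta12LiveOfFamily]; linarith)

end Kappa

/-! ## §2. ★ LOCATED-N10-ELL: THE BLOCK-SIZE ROW OPENS — every witness over the dictionary of record has `L = 3`, so N10's LEVEL-T faces (`8 ≤ L`) are vacuous there -/

section Ell

variable (F : T4Family) (N : ℕ) [NeZero N]

/-- **Every Stage-12 witness made by NODE 00's maker carries the dictionary of record: `ℓ₆ = 2`** (`rfl`; `stage8OfNumerics` is `{ stage3OfRecord₁₂ with … }`).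
[cite: Balaban1984PropagatorsII, (2.16) p.225; Balaban1987RG1, p.253 («L an odd positive integer») (bookkeeping witness)] -/
theorem ell6_stage12OfNumerics (n : Stage12Numerics) (res : Residual₅ F N) (ζ : ZetaOfRecord F N n.ν n.τ9.M)
    (Rz : (K : ℕ) → Sect2.Residual (F.P K) (MatA N)) (Zt : (K : ℕ) → TkResidualW F N (FluctV N) K) :
    (stage12OfNumerics F N n res ζ Rz Zt).ℓ₆ = 2 := rfl

/-- … and `L = 3` (`rfl`). [cite: Balaban1987RG1, p.253 (bookkeeping witness)] -/
theorem L_stage12OfNumerics (n : Stage12Numerics) (res : Residual₅ F N) (ζ : ZetaOfRecord F N n.ν n.τ9.M)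
    (Rz : (K : ℕ) → Sect2.Residual (F.P K) (MatA N)) (Zt : (K : ℕ) → TkResidualW F N (FluctV N) K) :
    (stage12OfNumerics F N n res ζ Rz Zt).L = 3 := rfl

/-- The live re-pin keeps the block-size index (`rfl`: only the `p–p′` selector changes). [cite: Balaban1989LargeFieldI, (0.3) p.176 (bookkeeping)] -/
theorem liveRepin_ℓ₆ (θ : Stage12Params F N) : (θ.liveRepin F N).ℓ₆ = θ.ℓ₆ := rfl

/-- **THE LOCATED VACUITY, generic**: at every witness made by NODE 00's maker the displayed binder `hL8 : 8 ≤ θ.ℓ₆ + 1` of N10's LEVEL-T faces is FALSE (`8 ≤ 3` fails).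
A located numeric demand on the witness's dictionary, NOT a refutation: print's `L` is an odd integer `> 11`. [cite: Balaban1988RG2Cluster, (2.36) p.19 and p.20 ll.2–3 (the transfer at ℓ = ½L); Balaban1987RG1, p.251 («L is an odd, positive integer > 11»)] -/
theorem not_eight_le_L_stage12OfNumerics (n : Stage12Numerics) (res : Residual₅ F N) (ζ : ZetaOfRecord F N n.ν n.τ9.M)
    (Rz : (K : ℕ) → Sect2.Residual (F.P K) (MatA N)) (Zt : (K : ℕ) → TkResidualW F N (FluctV N) K) :
    ¬ 8 ≤ (stage12OfNumerics F N n res ζ Rz Zt).ℓ₆ + 1 := by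
  rw [ell6_stage12OfNumerics]; decide

/-- … and at its live re-pin. [cite: Balaban1988RG2Cluster, (2.36) p.19; Balaban1987RG1, p.251] -/
theorem not_eight_le_L_liveRepin_stage12OfNumerics (n : Stage12Numerics) (res : Residual₅ F N) (ζ : ZetaOfRecord F N n.ν n.τ9.M)
    (Rz : (K : ℕ) → Sect2.Residual (F.P K) (MatA N)) (Zt : (K : ℕ) → TkResidualW F N (FluctV N) K) :
    ¬ 8 ≤ ((stage12OfNumerics F N n res ζ Rz Zt).liveRepin F N).ℓ₆ + 1 := by
  rw [liveRepin_ℓ₆, ell6_stage12OfNumerics]; decide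

/-- K0′'s witness of record θ₀ (`theta12OfRecord`, NODE 00's displayed numerics) carries `ℓ₆ = 2` (`rfl`). [cite: Balaban1987RG1, p.253 (bookkeeping witness)] -/
theorem ell6_theta12OfRecord (ζ : ZetaOfRecord F N numerics7OfRecord₁₂ 1) (Rz : (K : ℕ) → Sect2.Residual (F.P K) (MatA N))
    (Zt : (K : ℕ) → TkResidualW F N (FluctV N) K) : (theta12OfRecord F N ζ Rz Zt).ℓ₆ = 2 := rfl

/-- **AT K0′'s WITNESS OF RECORD θ₀** (`theta12OfRecord`): `¬ 8 ≤ θ₀.ℓ₆ + 1`. [cite: Balaban1988RG2Cluster, (2.36) p.19; Balaban1987RG1, p.251] -/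
theorem not_eight_le_L_theta12OfRecord (ζ : ZetaOfRecord F N numerics7OfRecord₁₂ 1) (Rz : (K : ℕ) → Sect2.Residual (F.P K) (MatA N))
    (Zt : (K : ℕ) → TkResidualW F N (FluctV N) K) : ¬ 8 ≤ (theta12OfRecord F N ζ Rz Zt).ℓ₆ + 1 := by
  rw [ell6_theta12OfRecord]; decide

/-- **AT THE RE-PINNED WITNESS OF RECORD θ₀ˡⁱᵛᵉ** (`theta12LiveOfRecord`, director-ym №114 (α)): `¬ 8 ≤ θ₀ˡⁱᵛᵉ.ℓ₆ + 1`. [cite: Balaban1988RG2Cluster, (2.36) p.19; Balaban1987RG1, p.251] -/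
theorem not_eight_le_L_theta12LiveOfRecord (ζ : ZetaOfRecord F N numerics7OfRecord₁₂ 1) (Rz : (K : ℕ) → Sect2.Residual (F.P K) (MatA N))
    (Zt : (K : ℕ) → TkResidualW F N (FluctV N) K) : ¬ 8 ≤ (theta12LiveOfRecord F N ζ Rz Zt).ℓ₆ + 1 := by
  rw [theta12LiveOfRecord_eq, liveRepin_ℓ₆, ell6_theta12OfRecord]; decide

variable (ε₀ : ℝ) (ζ : ZetaOfRecord F N (numerics7OfFamily ε₀) 1) (Rz : (K : ℕ) → Sect2.Residual (F.P K) (MatA N))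
  (Zt : (K : ℕ) → TkResidualW F N (FluctV N) K)

/-- **AT THE FAMILY WITNESS θ₀ᶠᵃᵐ(ε₀)** (node00-def-K0a's `theta12OfFamily`, κ re-pinned, `ε₀` open): `¬ 8 ≤ θ₀ᶠᵃᵐ.ℓ₆ + 1` — so N10's LEVEL-T family junction at the letters
of record, `…N10AtRecord12B13Family.b13FamLeafOfRecord₁₂_of_located_termwise`, CANNOT be instantiated at θ₀ᶠᵃᵐ (its binder `hL8` is unsatisfiable), while the FLAG junction
`b13FamLeafOfRecord₁₂_of_located` can (§1 supplies its rate rows).  [cite: Balaban1988RG2Cluster, (2.36) p.19, Lemma 3 p.20; Balaban1987RG1, p.251] -/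
theorem not_eight_le_L_theta12OfFamily : ¬ 8 ≤ (theta12OfFamily F N ε₀ ζ Rz Zt).ℓ₆ + 1 := by
  rw [theta12OfFamily_ℓ₆]; decide

/-- **AT THE LIVE FAMILY WITNESS θ₀ᶠᵃᵐ,ˡⁱᵛᵉ(ε₀)** (`theta12LiveOfFamily`): `¬ 8 ≤ ℓ₆ + 1`. [cite: Balaban1988RG2Cluster, (2.36) p.19; Balaban1987RG1, p.251] -/
theorem not_eight_le_L_theta12LiveOfFamily : ¬ 8 ≤ (theta12LiveOfFamily F N ε₀ ζ Rz Zt).ℓ₆ + 1 := by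
  rw [theta12LiveOfFamily_eq, liveRepin_ℓ₆, theta12OfFamily_ℓ₆]; decide

/-- **The other dictionary-reading binder at `L = 3`**: the torus-size condition `hN12 : 12 ≤ (ℓ₆ + 1)·(n + 1)` of N10's junctions ([I] (3.54) needs twelve sites per
direction) holds at the dictionary of record iff the member's torus index has `n ≥ 3` (at print's `L ≥ 13` it holds from `n = 0`). [cite: Balaban1987RG1, (3.54) p.285 (bookkeeping numeral)] -/
theorem twelve_le_three_mul_iff (n : ℕ) : 12 ≤ 3 * (n + 1) ↔ 3 ≤ n := by
  omega

/-- **PRINT's WINDOW MAKES THE BINDER A THEOREM**: at any Stage-12 package whose dictionary block size `ℓ₆ + 1` IS some `T4Family`'s `L` (print has ONE block size: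
[I] p.251 (0.1), «L is an odd, positive integer > 11» = `T4Family.hL11`), `8 ≤ θ.ℓ₆ + 1` — the shape of the cure for LOCATED-N10-ELL (a ₁₃ dictionary reading the
family's `F.L`; the K0′ lineage's to declare). [cite: Balaban1987RG1, p.251 («L is an odd, positive integer > 11»); Balaban1988RG2Cluster, (2.36) p.19] -/
theorem eight_le_L_of_L_eq_family (θ : Stage12Params F N) (F' : T4Family) (h : θ.ℓ₆ + 1 = F'.L) : 8 ≤ θ.ℓ₆ + 1 := by
  have h11 := F'.hL11
  omega

/-- In particular every `T4Family`'s own block size passes the (2.36)-as-printed threshold: `8 ≤ F.L`. [cite: Balaban1987RG1, p.251; Balaban1988RG2Cluster, (2.36) p.19] -/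
theorem eight_le_familyL (F' : T4Family) : 8 ≤ F'.L := by
  have h11 := F'.hL11
  omega

/-- **The binder-discharge shape of the cure at the dictionary level**: any Stage-3 dictionary whose block size `L` IS a `T4Family`'s (e.g. a ₁₃ dictionary
`{ stage3OfRecord₁₂ with L := F.L, ℓ₆ := F.L − 1, … }` reading the family) has `8 ≤ ℓ₆ + 1` (`Stage3Params.hℓ₆ : ℓ₆ + 1 = L`, `T4Family.hL11`).
[cite: Balaban1987RG1, p.251 («L is an odd, positive integer > 11»); Balaban1984PropagatorsII, (2.1)–(2.4) p.224 (the dictionary's `L`)] -/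
theorem eight_le_L_of_stage3_L_eq (θ₃ : Stage3Params) (F' : T4Family) (h : θ₃.L = F'.L) : 8 ≤ θ₃.ℓ₆ + 1 := by
  rw [θ₃.hℓ₆, h]
  exact eight_le_familyL F'

end Ell

/-! ## §3. THE FLAG JUNCTION WITH THE RATE ROWS DISCHARGED — at ANY Stage-12 package carrying the re-pinned rate (`2·10⁴ ≤ κ`), e.g. θ₀ᶠᵃᵐ(ε₀) -/

section FlagAtRate

variable (F : T4Family) (N : ℕ) [NeZero N]
variable (θ : Stage12Params F N) (c : B13.Consts) (lamF : ResidB13Fam₁₂ F N θ) (P : B12.RunParams)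

/-- `log x ≤ x − 1` in the two shapes of Lemma 1's residual-letter thresholds: `1 + 2·log(8·12³) ≤ 27647` and `2 + 16·log 128 ≤ 2034`. [cite: Balaban1988RG2Cluster, p.9 (R7 before Lemma 1; bookkeeping numerals)] -/
theorem kappa1_rows_of_ge {κ₁ : ℝ} (h : 320001 ≤ κ₁) : 1 + 2 * Real.log (8 * 12 ^ 3) ≤ κ₁ ∧ 2 + 16 * Real.log 128 ≤ κ₁ := by
  have h1 : Real.log (8 * 12 ^ 3) ≤ 8 * 12 ^ 3 - 1 := Real.log_le_sub_one_of_pos (by norm_num)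
  have h2 : Real.log 128 ≤ 128 - 1 := Real.log_le_sub_one_of_pos (by norm_num)
  constructor <;> nlinarith

set_option maxSynthPendingDepth 3 in
/-- **THE [B13] FAMILY LEAF OF RECORD AT A STAGE-12 RUN FROM THE FLAG JUNCTION, WITH THE EIGHT RATE ∕ κ₁ ROWS OF LEMMA 1 DISCHARGED BY THE RE-PINNED RATE**:
`…N10AtRecord12B13Family.b13FamLeafOfRecord₁₂_of_located` with its binders `hκ hδκ hκ126 hκ126' hR8 hR9` (θ's (I.1.18) rate at the record's δ) and `hκ₁ hκ₁'` (the
residual `κ₁`) REPLACED by `2·10⁴ ≤ θ.s2.lf.κ` and `16·θ.s2.lf.κ + 1 ≤ c.κ₁` (`thresholds_of_kappa_ge` + `kappa1_rows_of_ge`); every other located input, the member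
letters law, the index law and the member-wise Lemma-3 FLAG `h3` VERBATIM.  At the family witness θ₀ᶠᵃᵐ(ε₀) (`theta12OfFamily_κ`, §1) `hκ` is `kp_n10_theta12OfFamily` and
`hκ₁` reads `320001 ≤ c.κ₁`; this is the face a K1′ assembler at the re-pinned witness passes N10 through WITH LEMMA 3 AS THE FLAG (§2: the level-T face is closed to
it until the dictionary's `L` is re-pinned).  Count-neutral: hypotheses about the HIDDEN family; nothing of Bałaban's asserted.
[cite: Balaban1988RG2Cluster, Lemma 1 p.9, Lemma 2 p.11, Lemma 3 p.20, (1.26) p.8, p.21 (after (2.41)); Balaban1987RG1, Thm 3 p.264, (1.18) p.263] -/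
theorem b13FamLeafOfRecord₁₂_of_located_of_kappa_ge
    (hc : ∀ k v, v ∈ FlowStep.Box θ.γ k → (lamF P k v).c = c13OfRecord₁₂ F N θ c) (hidx : ResidB13Fam.IsStepIndexed θ.γ (lamF P))
    (hN12 : ∀ k v, v ∈ FlowStep.Box θ.γ k → 12 ≤ (θ.ℓ₆ + 1) * ((lamF P k v).n + 1))
    -- (1) LEMMA 1: [I]'s block geometry of the (1.33) index families of every member in the box
    (dist : (k : ℕ) → (v : Fin (k + 1) → ℝ) → TDom 4 ((θ.ℓ₆ + 1) * ((lamF P k v).n + 1)) → TPt 4 ((θ.ℓ₆ + 1) * ((lamF P k v).n + 1)) → (j : ℕ) →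
      TPt 4 ((θ.ℓ₆ + 1) ^ ((lamF P k v).k - j) * ((θ.ℓ₆ + 1) * ((lamF P k v).n + 1))) → ℝ) {K K' : ℝ}
    (hS0Y : ∀ k v, v ∈ FlowStep.Box θ.γ k → ∀ Y, ∀ a ∈ (lamF P k v).S0 Y,
      (pbox (fun i => natLift a i - (5 : ℕ)) (fun i => natLift a i + 1 + (5 : ℕ))).image (proj ((θ.ℓ₆ + 1) * ((lamF P k v).n + 1))) ⊆ Y.1)
    (hFsub : ∀ k v, v ∈ FlowStep.Box θ.γ k → ∀ Y a, (lamF P k v).F Y a ⊆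
      (pbox (fun i => natLift a i - (5 : ℕ)) (fun i => natLift a i + 1 + (5 : ℕ))).image (proj ((θ.ℓ₆ + 1) * ((lamF P k v).n + 1))) \
        (pbox (fun i => natLift a i - (4 : ℕ)) (fun i => natLift a i + 1 + (4 : ℕ))).image (proj ((θ.ℓ₆ + 1) * ((lamF P k v).n + 1))))
    (hSq : ∀ k v, v ∈ FlowStep.Box θ.γ k → ∀ Y, ∀ a ∈ (lamF P k v).S0 Y, ∀ j, (lamF P k v).Sq Y a j ⊆
      (Finset.univ : Finset (TPt 4 ((θ.ℓ₆ + 1) ^ ((lamF P k v).k - j) * ((θ.ℓ₆ + 1) * ((lamF P k v).n + 1))))).filter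
        (fun q => tcoarse ((θ.ℓ₆ + 1) ^ ((lamF P k v).k - j)) ((θ.ℓ₆ + 1) * ((lamF P k v).n + 1)) q ∈
          (pbox (fun i => natLift a i - (2 : ℕ)) (fun i => natLift a i + 1 + (2 : ℕ))).image (proj ((θ.ℓ₆ + 1) * ((lamF P k v).n + 1)))))
    (hScY : ∀ k v, v ∈ FlowStep.Box θ.γ k → ∀ Y, (lamF P k v).Sc Y ⊆ Y.1)
    (hdist0 : ∀ k v, v ∈ FlowStep.Box θ.γ k → ∀ Y a j q, 0 ≤ c.δ₀ * dist k v Y a j q)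
    (hdist : ∀ k v, v ∈ FlowStep.Box θ.γ k → ∀ Y a j (n : ℕ) q,
      q ∉ (pbox (fun i => (((θ.ℓ₆ + 1) ^ ((lamF P k v).k - j) : ℕ) : ℤ) * natLift a i - (n + 1 : ℕ))
        (fun i => (((θ.ℓ₆ + 1) ^ ((lamF P k v).k - j) : ℕ) : ℤ) * natLift a i + 2 * (((θ.ℓ₆ + 1) ^ ((lamF P k v).k - j) : ℕ) : ℤ) - 1 + (n + 1 : ℕ))).image
          (proj ((θ.ℓ₆ + 1) ^ ((lamF P k v).k - j) * ((θ.ℓ₆ + 1) * ((lamF P k v).n + 1)))) →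
        c.δ₀ * c.M * ((n : ℝ) + 1) ≤ c.δ₀ * dist k v Y a j q)
    (hSX : ∀ k v, v ∈ FlowStep.Box θ.γ k → ∀ Y a j q,
      (lamF P k v).SX Y a j q ⊆ (tcubeSys 4 ((θ.ℓ₆ + 1) ^ ((lamF P k v).k - j) * ((θ.ℓ₆ + 1) * ((lamF P k v).n + 1)))).above q)
    (hSX' : ∀ k v, v ∈ FlowStep.Box θ.γ k → ∀ Y a j q,
      (lamF P k v).SX' Y a j q ⊆ (tcubeSys 4 ((θ.ℓ₆ + 1) ^ ((lamF P k v).k - j) * ((θ.ℓ₆ + 1) * ((lamF P k v).n + 1)))).above q)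
    (hX0 : ∀ k v, v ∈ FlowStep.Box θ.γ k → ∀ Y, ∀ a ∈ (lamF P k v).Sc Y, ∀ j ∈ Finset.range ((lamF P k v).k + 1), ∀ q ∈ (lamF P k v).Sq' Y a j,
      ∀ x ∈ (lamF P k v).SX' Y a j q, x.1.image (tcoarse ((θ.ℓ₆ + 1) ^ ((lamF P k v).k - j)) ((θ.ℓ₆ + 1) * ((lamF P k v).n + 1))) ⊆ Y.1)
    -- (1) LEMMA 1: per-term analyticity on (1.34), every member in the box
    (hAnT : ∀ k v, v ∈ FlowStep.Box θ.γ k → ∀ Y, ∀ a ∈ (lamF P k v).S0 Y, ∀ X ∈ ((lamF P k v).F Y a).powerset, ∀ j ∈ Finset.range ((lamF P k v).k + 1),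
      ∀ q ∈ (lamF P k v).Sq Y a j, ∀ x ∈ (lamF P k v).SX Y a j q, AnalyticOnNhd ℂ ((lamF P k v).T Y a X j q x) ((lamF P k v).sp1 Y))
    (hAnT' : ∀ k v, v ∈ FlowStep.Box θ.γ k → ∀ Y, ∀ a ∈ (lamF P k v).Sc Y, ∀ j ∈ Finset.range ((lamF P k v).k + 1), ∀ q ∈ (lamF P k v).Sq' Y a j,
      ∀ x ∈ (lamF P k v).SX' Y a j q, AnalyticOnNhd ℂ ((lamF P k v).T' Y a j q x) ((lamF P k v).sp1 Y))
    -- (1) LEMMA 1: the k-UNIFORM thresholds — the EIGHT rate∕κ₁ rows REPLACED by the re-pinned rate `2·10⁴ ≤ κ` and the residual `κ₁ ≥ 16κ + 1`; `δ < 1` DISCHARGED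
    (hK : 0 ≤ K) (hK' : 0 ≤ K') (hκ : 2 * 10 ^ 4 ≤ θ.s2.lf.κ) (hκ₁ : 16 * θ.s2.lf.κ + 1 ≤ c.κ₁)
    (hδ₀M : 10 * Real.exp (-1) ≤ c.δ₀ * c.M) (hδ₀M5 : 2 * Real.log 5 ≤ c.δ₀ * c.M)
    -- (1) LEMMA 1: per-term (1.24), (1.30) by reference to [I] (3.54), (3.17), [15] Prop. 4, [13] (3.108), every member in the box; k-UNIFORM `K, K′`; the choice `hC` reads θ's `E₀`
    (h124 : ∀ k v, v ∈ FlowStep.Box θ.γ k → ∀ Y φ, φ ∈ (lamF P k v).sp1 Y → ∀ a ∈ (lamF P k v).S0 Y, ∀ X ∈ ((lamF P k v).F Y a).powerset,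
      ∀ j ∈ Finset.range ((lamF P k v).k + 1), ∀ q ∈ (lamF P k v).Sq Y a j, ∀ x ∈ (lamF P k v).SX Y a j q,
        ‖(lamF P k v).T Y a X j q x φ‖ ≤ K * (((θ.ℓ₆ + 1 : ℕ) : ℝ) ^ j * (((θ.ℓ₆ + 1 : ℕ) : ℝ) ^ (lamF P k v).k)⁻¹) ^ 5 *
          Real.exp (-(c.κ₁ - 1) *
            (((Y.1 \ (pbox (fun i => natLift a i - (5 : ℕ)) (fun i => natLift a i + 1 + (5 : ℕ))).image
              (proj ((θ.ℓ₆ + 1) * ((lamF P k v).n + 1)))).card : ℝ) + X.card)) *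
          Real.exp (-(θ.s2.lf.κ * torusTreeLen x.1)))
    (h130 : ∀ k v, v ∈ FlowStep.Box θ.γ k → ∀ Y φ, φ ∈ (lamF P k v).sp1 Y → ∀ a ∈ (lamF P k v).Sc Y, ∀ j ∈ Finset.range ((lamF P k v).k + 1),
      ∀ q ∈ (lamF P k v).Sq' Y a j, ∀ x ∈ (lamF P k v).SX' Y a j q,
        ‖(lamF P k v).T' Y a j q x φ‖ ≤ K' * Real.exp (-(1 / 2) * (c.δ₀ * c.M) * (((θ.ℓ₆ + 1 : ℕ) : ℝ) ^ j * (((θ.ℓ₆ + 1 : ℕ) : ℝ) ^ (lamF P k v).k)⁻¹)⁻¹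
            - (1 / 2) * c.δ₀ * dist k v Y a j q) *
          Real.exp (-(c.κ₁ - 1) * ((Y.1 \ x.1.image (tcoarse ((θ.ℓ₆ + 1) ^ ((lamF P k v).k - j)) ((θ.ℓ₆ + 1) * ((lamF P k v).n + 1)))).card : ℝ)) *
          Real.exp (-(θ.s2.lf.κ * torusTreeLen x.1)))
    {ϑ : ℝ} (hϑ0 : 0 ≤ ϑ) (hϑ1 : ϑ < 1)
    (hC : K * K₀ 64 8 * (2 * (6 * ((θ.ℓ₆ + 1 : ℕ) : ℝ)) ^ 4) * Real.exp 1 * Real.exp ((1 / 8) * c.κ₁ * (12 ^ 4 - 1)) +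
        2 * (64 * K') * K₀ 64 8 * 1344 ≤
      (1 - ϑ) * (θ.s2.lf.E₀ * c.ε₁ * c.C₁ * c.M ^ c.q * Real.exp (c.C₂ * c.κ₁)))
    -- (2) LEMMA 2 (pp. 10–11): the curvature terms and the plaquette data of every member in the box; k-UNIFORM `ϑ, R, K₂, m₂`; `g_k ≠ 0` DISCHARGED (index law)
    (hGlAn : ∀ k v, v ∈ FlowStep.Box θ.γ k → ∀ Y, AnalyticOnNhd ℂ ((lamF P k v).Gl Y) ((lamF P k v).sp1 Y))
    (hGl : ∀ k v, v ∈ FlowStep.Box θ.γ k → ∀ Y φ, φ ∈ (lamF P k v).sp1 Y →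
      ‖(lamF P k v).Gl Y φ‖ ≤ ϑ * (θ.s2.lf.E₀ * c.ε₁ * c.C₁ * c.M ^ c.q * Real.exp (c.C₂ * c.κ₁)) *
        Real.exp (-((1 - 2 * (c13OfRecord₁₂ F N θ c).δ) * θ.s2.lf.κ * (tsys 4 ((θ.ℓ₆ + 1) * ((lamF P k v).n + 1))).dj Y)))
    (he : ∀ k v, v ∈ FlowStep.Box θ.γ k → ∀ Y b, ‖(lamF P k v).e Y b‖ ≤ 1)
    {R K₂ : ℝ} {m₂ : ℕ} (hK₂ : 0 ≤ K₂) (hR : 0 < R) (hε3 : 3 * c.ε₁ ≤ R)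
    (hW : ∀ k v, v ∈ FlowStep.Box θ.γ k → ∀ Y, ∀ i ∈ (lamF P k v).s Y, ∀ φ ∈ (lamF P k v).sp1 Y, AnalyticOnNhd ℂ ((lamF P k v).Wf Y i φ) (ball 0 R))
    (hKW : ∀ k v, v ∈ FlowStep.Box θ.γ k → ∀ Y, ∀ i ∈ (lamF P k v).s Y, ∀ φ ∈ (lamF P k v).sp1 Y, ∀ z ∈ ball (0 : (lamF P k v).E) R,
      ‖(lamF P k v).Wf Y i φ z‖ ≤ K₂ * Real.exp (-(c.κ₁ - 1) * ((Y.1.card : ℝ) - 1)) * ‖z‖ ^ 3)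
    (hcard : ∀ k v, v ∈ FlowStep.Box θ.γ k → ∀ Y, ((lamF P k v).s Y).card ≤ m₂ * Y.1.card)
    (hsp : ∀ k v, v ∈ FlowStep.Box θ.γ k → ∀ Y φ, φ ∈ (lamF P k v).sp1 Y → ‖(lamF P k v).g‖ * ‖(lamF P k v).rd Y φ‖ < c.ε₁)
    (hfloor : 27 * m₂ * K₂ * Real.exp (c.κ₁ - 1) ≤ c.C₃ * c.M ^ 4 * Real.exp (c.C₂ * c.κ₁))
    (hAnP : ∀ k v, v ∈ FlowStep.Box θ.γ k → ∀ Y, ∀ i ∈ (lamF P k v).s Y,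
      AnalyticOnNhd ℂ (fun φ => scaled (lamF P k v).g ((lamF P k v).Wf Y i φ) ((lamF P k v).rd Y φ)) ((lamF P k v).sp1 Y))
    (hG : ∀ k v, v ∈ FlowStep.Box θ.γ k → ∀ Y, (lamF P k v).GaugeInv ((lamF P k v).V Y) ∧
      (lamF P k v).GaugeInv ((WtOfRecord θ.toStage3Params (lamF P k v)).toStepData.quadForm Y) ∧ (lamF P k v).GaugeInv ((lamF P k v).Vpp Y))
    -- (3) LEMMA 3 (p. 20): THE LOCATED FLAG, member-wise, at the letters of record — NODE A's content, displayed
    (h3 : ∀ k v, v ∈ FlowStep.Box θ.γ k → B13.Lemma3Printed (WtOfRecord θ.toStage3Params (lamF P k v)).toStepData (c13OfRecord₁₂ F N θ c)) :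
    B13FamLeafOfRecord₁₂ F N θ c lamF P := by
  obtain ⟨hκ0, hδκ, hκ126, hκ126', hR8, hR9⟩ := thresholds_of_kappa_ge F N θ c hκ hκ₁
  obtain ⟨hκ₁a, hκ₁b⟩ := kappa1_rows_of_ge (κ₁ := c.κ₁) (by linarith)
  exact b13FamLeafOfRecord₁₂_of_located F N θ c lamF P hc hidx hN12 dist hS0Y hFsub hSq hScY hdist0 hdist hSX hSX' hX0 hAnT hAnT' hK hK'
    hκ0 hδκ hκ126 hκ126' hκ₁a hκ₁b hδ₀M hδ₀M5 hR8 hR9 h124 h130 hϑ0 hϑ1 hC hGlAn hGl he hK₂ hR hε3 hW hKW hcard hsp hfloor hAnP hG h3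

end FlagAtRate

end Summit.QuantumFields.YangMills.BalabanUVNodes.N10AtRecord12B13FamilyWitness
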